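import Mathlib.RingTheory.Localization.LocalizationLocalization
import Mathlib.RingTheory.Localization.Module
import Mathlib.Algebra.Module.LocalizedModule.IsLocalization
import Mathlib.RingTheory.Ideal.Quotient.Operations
import Summits.ResolutionOfSingularities.ResolutionOfSingularities.Theorems.FrobeniusLadderFRationalResolutionStubClauseOfRingEquiv
import Summits.ResolutionOfSingularities.ResolutionOfSingularities.Theorems.FrobeniusLadderFInjectiveMacaulayficationDegreeZeroDescent
import Summits.ResolutionOfSingularities.ResolutionOfSingularities.Theorems.FrobeniusLadderFInjectiveMacaulayficationGradedZero
import Mathlib.RingTheory.Noetherian.Basic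
import HarnessLib

/-!
# Degree-zero descent, localized form (the clause at a prime of `A` from the local rings of `B`)

Support file for crux stmt-ResolutionOfSingularities-15315 (`FrobeniusLadder.FInjectiveMacaulayfication`,
line `Sketch`, lead seat c3, cycle 4); sequel of `…DegreeZeroDescent.lean` (`clause_of_retract`,
`inlineClause_of_retract`: descent of the Cohen–Macaulay + F-injective clause along an `A`-linear
retraction `B → A` for `A` LOCAL).

Here `A` is no longer local: for a map of Noetherian rings `A → B` with an `A`-linear retraction (`A` of
prime characteristic `p`; e.g. the degree-`0` part `T₀ ⊆ T` of a `ℤ`-graded ring,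
`GradedZero.stub_projZeroRetract`) and a prime `n` of `A`, `inlineClause_localization_of_retract` proves the
crux's per-stalk clause for `A_n` from hypotheses on the local rings `B_Q` at the primes `Q` of `B` that are
maximal among those with `Q ∩ A ⊆ n` — exactly the maximal ideals of `B_n = (A ∖ n)⁻¹B` — stated through the
induced maps `ψ : A_n → B_Q`. Ingredients: a retraction localizes (`exists_retract_localization`, via
`IsLocalizedModule.mapExtendScalars`), `(B_n)_𝔓 ≅ B_Q`
(`IsLocalization.localizationLocalizationAtPrimeIsoLocalization`), and transport of the clause along ring
isomorphisms without a domain hypothesis (§1, `inlineClause_of_ringEquiv`). No local cohomology, no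
F-finiteness, no flatness; any weights in the graded application.
-/

-- single-problem summit: the doubled namespace component is forced
set_option linter.dupNamespace false

namespace Summit.ResolutionOfSingularities.ResolutionOfSingularities.Theorems.FInjectiveMacaulayfication.DegreeZeroDescent

open IsLocalRing RingTheory.Sequence Literature.RingTheory.TightClosure

variable (p : ℕ) [Fact p.Prime]

/-! ## §1 Transport along ring isomorphisms (no domain hypothesis) -/

omit [Fact (Nat.Prime p)] in
/-- A ring isomorphism carries weakly regular sequences (of a ring on itself) to weakly regular sequences.
[folklore] -/
-- adapted from Literature/AlgebraicGeometry/Resolution/BlowupChartRsop.lean (`RingEquiv.isWeaklyRegular_map_iff`)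
theorem isWeaklyRegular_map_ringEquiv {S S' : Type} [CommRing S] [CommRing S'] (ε : S ≃+* S')
    {rs : List S} (h : IsWeaklyRegular S rs) : IsWeaklyRegular S' (rs.map ε) := by
  refine (AddEquiv.isWeaklyRegular_congr (e := ε.toAddEquiv) ?_).mp h
  refine List.forall₂_map_right_iff.mpr (List.forall₂_same.mpr fun r _ x => ?_)
  change ε (r * x) = ε r * ε x
  exact map_mul ε r x

omit [Fact (Nat.Prime p)] in
/-- The crux's inline clause (every system of parameters weakly regular with Frobenius closed ideal — WITHOUT
the domain conjunct) transports along a ring isomorphism. [folklore] -/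
theorem inlineClause_of_ringEquiv {L L' : Type} [CommRing L] [CommRing L'] (e : L ≃+* L')
    (h : ∀ d : ℕ, ringKrullDim L = d → ∀ s : Fin d → L, (Ideal.span (Set.range s)).radical.IsMaximal →
      IsWeaklyRegular L (List.ofFn s) ∧
      ∀ y : L, (∃ e : ℕ, y ^ p ^ e ∈ Ideal.span ((fun z : L => z ^ p ^ e) ''
        (Ideal.span (Set.range s) : Set L))) → y ∈ Ideal.span (Set.range s)) :
    ∀ d : ℕ, ringKrullDim L' = d → ∀ s : Fin d → L', (Ideal.span (Set.range s)).radical.IsMaximal →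
      IsWeaklyRegular L' (List.ofFn s) ∧
      ∀ y : L', (∃ e : ℕ, y ^ p ^ e ∈ Ideal.span ((fun z : L' => z ^ p ^ e) ''
        (Ideal.span (Set.range s) : Set L'))) → y ∈ Ideal.span (Set.range s) := by
  intro d hd s hmax
  have hdL : ringKrullDim L = d := by rw [ringKrullDim_eq_of_ringEquiv e, hd]
  have hI := FRationalResolution.ClauseInvariance.span_range_symm_comp e s
  have hmaxL : (Ideal.span (Set.range (e.symm ∘ s))).radical.IsMaximal := by
    rw [hI, ← Ideal.comap_radical]
    exact Ideal.comap_isMaximal_of_equiv e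
  obtain ⟨hW, hF⟩ := h d hdL (e.symm ∘ s) hmaxL
  refine ⟨?_, ?_⟩
  · have h1 := isWeaklyRegular_map_ringEquiv e hW
    have hl : (List.ofFn (e.symm ∘ s)).map e = List.ofFn s := by
      rw [List.map_ofFn]
      congr 1
      funext i
      exact e.apply_symm_apply (s i)
    rwa [hl] at h1
  · rintro y ⟨n, hn⟩
    have hmem : e.symm y ^ p ^ n ∈ Ideal.span ((fun z : L => z ^ p ^ n) ''
        (Ideal.span (Set.range (e.symm ∘ s)) : Set L)) := by
      rw [hI]
      have h1 := FRationalResolution.ClauseInvariance.symm_mem_span_pow_image e p n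
        (Ideal.span (Set.range s)) (y := y) (c := 1) (by rwa [one_mul])
      rwa [map_one, one_mul] at h1
    have hy := hF (e.symm y) ⟨n, hmem⟩
    rwa [hI, Ideal.mem_comap, RingEquiv.apply_symm_apply] at hy

/-! ## §2 Localization: the clause at a prime `n` of `A` from the local rings of `B` over `n` -/

omit [Fact (Nat.Prime p)] in
/-- **A retraction localizes**: if `ρ : B → A` is an `A`-linear retraction of `A → B` and `S ⊆ A` is
multiplicative, then `S⁻¹ρ : S⁻¹B → S⁻¹A` is an `S⁻¹A`-linear retraction of `S⁻¹A → S⁻¹B`, compatible with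
`ρ`. [folklore] -/
theorem exists_retract_localization {A B : Type} [CommRing A] [CommRing B] [Algebra A B]
    (ρ : B →ₗ[A] A) (hρ : ρ 1 = 1) (S : Submonoid A)
    (A' B' : Type) [CommRing A'] [CommRing B'] [Algebra A A'] [IsLocalization S A']
    [Algebra B B'] [IsLocalization (Algebra.algebraMapSubmonoid B S) B']
    [Algebra A' B'] [Algebra A B'] [IsScalarTower A B B'] [IsScalarTower A A' B'] :
    ∃ ρ' : B' →ₗ[A'] A', ρ' 1 = 1 ∧ ∀ b : B, ρ' (algebraMap B B' b) = algebraMap A A' (ρ b) := by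
  let f : B →ₗ[A] B' := (IsScalarTower.toAlgHom A B B').toLinearMap
  haveI : IsLocalizedModule S f := isLocalizedModule_iff_isLocalization.mpr inferInstance
  have hfb : ∀ b : B, f b = algebraMap B B' b := fun b => rfl
  refine ⟨IsLocalizedModule.mapExtendScalars S f (Algebra.linearMap A A') A' ρ, ?_, fun b => ?_⟩
  · rw [← map_one (algebraMap B B'), ← hfb, IsLocalizedModule.mapExtendScalars_apply_apply,
      IsLocalizedModule.map_apply, hρ]
    exact map_one (algebraMap A A')
  · rw [← hfb, IsLocalizedModule.mapExtendScalars_apply_apply, IsLocalizedModule.map_apply]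
    rfl

/-- **DEGREE-ZERO DESCENT, LOCALIZED FORM.** Let `A → B` be a map of Noetherian rings with an `A`-linear
retraction (`A` of prime characteristic `p`; e.g. `A = T₀ ⊆ T = B` a `ℤ`-graded ring with its degree-`0`
projection, `GradedZero.stub_projZeroRetract`) and `n` a prime of `A`. Suppose that for every system of
parameters `s` of `A_n` and every prime `Q` of `B` that is MAXIMAL among the primes with `Q ∩ A ⊆ n`, with
`ψ : A_n → B_Q` the induced map: if all `ψ(sᵢ)` lie in the maximal ideal of `B_Q`, then `B_Q` satisfies the
crux's clause and `dim B_Q = d + e`, `dim B_Q/(ψ s) = e` for some `e`; and otherwise the `ψ(sᵢ)` still form a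
weakly regular sequence on `B_Q`. Then `A_n` satisfies the per-stalk clause of
`FrobeniusLadder.FInjectiveMacaulayfication` (inline form, verbatim). Proof: `inlineClause_of_retract` for
`A_n → B_n := (A ∖ n)⁻¹B` with the localized retraction; the maximal ideals of `B_n` are exactly these `Q`,
and `(B_n)_𝔓 ≅ B_Q` (`IsLocalization.localizationLocalizationAtPrimeIsoLocalization`). [folklore] -/
theorem inlineClause_localization_of_retract {A B : Type} [CommRing A] [CommRing B] [IsNoetherianRing A]
    [IsNoetherianRing B] [CharP A p] [Algebra A B] (ρ : B →ₗ[A] A) (hρ : ρ 1 = 1)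
    (n : Ideal A) [n.IsPrime]
    (h : ∀ (d : ℕ) (s : Fin d → Localization.AtPrime n), IsSystemOfParameters s →
      ∀ (Q : Ideal B) [Q.IsPrime], Q.comap (algebraMap A B) ≤ n →
        (∀ Q' : Ideal B, Q'.IsPrime → Q ≤ Q' → Q'.comap (algebraMap A B) ≤ n → Q' ≤ Q) →
        ∀ ψ : Localization.AtPrime n →+* Localization.AtPrime Q,
          ψ.comp (algebraMap A (Localization.AtPrime n)) =
            (algebraMap B (Localization.AtPrime Q)).comp (algebraMap A B) →
          ((∀ i, ψ (s i) ∈ maximalIdeal (Localization.AtPrime Q)) →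
            (∀ m : ℕ, ringKrullDim (Localization.AtPrime Q) = m → ∀ u : Fin m → Localization.AtPrime Q,
              (Ideal.span (Set.range u)).radical.IsMaximal →
                IsWeaklyRegular (Localization.AtPrime Q) (List.ofFn u) ∧
                ∀ y : Localization.AtPrime Q, (∃ e : ℕ, y ^ p ^ e ∈ Ideal.span
                  ((fun z : Localization.AtPrime Q => z ^ p ^ e) ''
                    (Ideal.span (Set.range u) : Set (Localization.AtPrime Q)))) → y ∈ Ideal.span (Set.range u)) ∧
            ∃ e : ℕ, ringKrullDim (Localization.AtPrime Q) = ((d + e : ℕ) : WithBot ℕ∞) ∧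
              ringKrullDim (Localization.AtPrime Q ⧸ Ideal.span (Set.range fun i => ψ (s i))) =
                (e : WithBot ℕ∞)) ∧
          ((∃ i, ψ (s i) ∉ maximalIdeal (Localization.AtPrime Q)) →
            IsWeaklyRegular (Localization.AtPrime Q) (List.ofFn fun i => ψ (s i)))) :
    ∀ d : ℕ, ringKrullDim (Localization.AtPrime n) = d → ∀ s : Fin d → Localization.AtPrime n,
      (Ideal.span (Set.range s)).radical.IsMaximal →
      IsWeaklyRegular (Localization.AtPrime n) (List.ofFn s) ∧
      ∀ y : Localization.AtPrime n, (∃ e : ℕ, y ^ p ^ e ∈ Ideal.span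
        ((fun z : Localization.AtPrime n => z ^ p ^ e) ''
          (Ideal.span (Set.range s) : Set (Localization.AtPrime n)))) → y ∈ Ideal.span (Set.range s) := by
  set M := Algebra.algebraMapSubmonoid B n.primeCompl with hM
  obtain ⟨ρ', hρ'1, -⟩ := exists_retract_localization ρ hρ n.primeCompl (Localization.AtPrime n)
    (Localization M)
  haveI : CharP (Localization.AtPrime n) p := charP_localization_atPrime p n
  -- the common bookkeeping at a maximal ideal `P` of `B_n = Localization M`
  have key : ∀ (d : ℕ) (s : Fin d → Localization.AtPrime n), IsSystemOfParameters s →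
      ∀ (P : Ideal (Localization M)) [P.IsMaximal],
      ∃ (Q : Ideal B) (_ : Q.IsPrime) (e : Localization.AtPrime Q ≃+* Localization.AtPrime P)
        (ψ : Localization.AtPrime n →+* Localization.AtPrime Q),
        (∀ i, algebraMap (Localization M) (Localization.AtPrime P)
          (algebraMap (Localization.AtPrime n) (Localization M) (s i)) = e (ψ (s i))) ∧
        ((Ideal.span (Set.range s)).map (algebraMap (Localization.AtPrime n) (Localization M)) ≤ P ↔
          ∀ i, ψ (s i) ∈ maximalIdeal (Localization.AtPrime Q)) ∧
        (((∀ i, ψ (s i) ∈ maximalIdeal (Localization.AtPrime Q)) →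
            (∀ m : ℕ, ringKrullDim (Localization.AtPrime Q) = m → ∀ u : Fin m → Localization.AtPrime Q,
              (Ideal.span (Set.range u)).radical.IsMaximal →
                IsWeaklyRegular (Localization.AtPrime Q) (List.ofFn u) ∧
                ∀ y : Localization.AtPrime Q, (∃ e : ℕ, y ^ p ^ e ∈ Ideal.span
                  ((fun z : Localization.AtPrime Q => z ^ p ^ e) ''
                    (Ideal.span (Set.range u) : Set (Localization.AtPrime Q)))) → y ∈ Ideal.span (Set.range u)) ∧
            ∃ e : ℕ, ringKrullDim (Localization.AtPrime Q) = ((d + e : ℕ) : WithBot ℕ∞) ∧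
              ringKrullDim (Localization.AtPrime Q ⧸ Ideal.span (Set.range fun i => ψ (s i))) =
                (e : WithBot ℕ∞)) ∧
          ((∃ i, ψ (s i) ∉ maximalIdeal (Localization.AtPrime Q)) →
            IsWeaklyRegular (Localization.AtPrime Q) (List.ofFn fun i => ψ (s i)))) := by
    intro d s hs P _
    obtain ⟨hQprime, hdisj⟩ := (IsLocalization.isPrime_iff_isPrime_disjoint M (Localization M) P).mp
      inferInstance
    set Q : Ideal B := P.comap (algebraMap B (Localization M)) with hQ
    haveI : Q.IsPrime := hQprime
    -- `Q ∩ A ⊆ n`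
    have hQn : Q.comap (algebraMap A B) ≤ n := by
      intro a ha
      by_contra han
      have hmem : algebraMap A B a ∈ M := ⟨a, han, rfl⟩
      exact Set.disjoint_left.mp hdisj hmem ha
    -- maximality of `Q` among the primes over `n`
    have hQmax : ∀ Q' : Ideal B, Q'.IsPrime → Q ≤ Q' → Q'.comap (algebraMap A B) ≤ n → Q' ≤ Q := by
      intro Q' hQ' hQQ' hQ'n
      have hdisj' : Disjoint (M : Set B) (Q' : Set B) := by
        refine Set.disjoint_left.mpr ?_
        rintro x ⟨a, ha, rfl⟩ hx
        exact ha (hQ'n hx)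
      have hP' : (Q'.map (algebraMap B (Localization M))).IsPrime :=
        IsLocalization.isPrime_of_isPrime_disjoint M (Localization M) Q' hQ' hdisj'
      have hPP' : P ≤ Q'.map (algebraMap B (Localization M)) := by
        rw [← IsLocalization.map_under M (Localization M) P]
        exact Ideal.map_mono hQQ'
      have hEq : Q'.map (algebraMap B (Localization M)) = P :=
        (Ideal.IsMaximal.eq_of_le inferInstance hP'.ne_top hPP').symm
      calc Q' ≤ (Q'.map (algebraMap B (Localization M))).comap (algebraMap B (Localization M)) :=
            Ideal.le_comap_map
        _ = Q := by rw [hEq]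
    -- the iso `B_Q ≅ (B_n)_P` and the induced map `ψ : A_n → B_Q`
    let eA := IsLocalization.localizationLocalizationAtPrimeIsoLocalization M P
    let e : Localization.AtPrime Q ≃+* Localization.AtPrime P := eA.toRingEquiv
    have he : ∀ b : B, e (algebraMap B (Localization.AtPrime Q) b) =
        algebraMap (Localization M) (Localization.AtPrime P) (algebraMap B (Localization M) b) := by
      intro b
      change eA (algebraMap B (Localization.AtPrime Q) b) = _
      rw [AlgEquiv.commutes, IsScalarTower.algebraMap_apply B (Localization M) (Localization.AtPrime P)]
    let ψ : Localization.AtPrime n →+* Localization.AtPrime Q :=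
      e.symm.toRingHom.comp ((algebraMap (Localization M) (Localization.AtPrime P)).comp
        (algebraMap (Localization.AtPrime n) (Localization M)))
    have hψ : ∀ x, e (ψ x) = algebraMap (Localization M) (Localization.AtPrime P)
        (algebraMap (Localization.AtPrime n) (Localization M) x) := fun x => e.apply_symm_apply _
    have hψcomp : ψ.comp (algebraMap A (Localization.AtPrime n)) =
        (algebraMap B (Localization.AtPrime Q)).comp (algebraMap A B) := by
      ext a
      apply e.injective
      change e (ψ (algebraMap A (Localization.AtPrime n) a)) = e (algebraMap B _ (algebraMap A B a))
      rw [hψ, he, ← IsScalarTower.algebraMap_apply A (Localization.AtPrime n) (Localization M),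
        IsScalarTower.algebraMap_apply A B (Localization M)]
    -- membership in `P` versus the maximal ideal of `B_Q`
    have hmemiff : ∀ i, algebraMap (Localization.AtPrime n) (Localization M) (s i) ∈ P ↔
        ψ (s i) ∈ maximalIdeal (Localization.AtPrime Q) := by
      intro i
      rw [← IsLocalization.AtPrime.to_map_mem_maximal_iff (Localization.AtPrime P) P, ← hψ,
        IsLocalRing.mem_maximalIdeal, IsLocalRing.mem_maximalIdeal, mem_nonunits_iff, mem_nonunits_iff]
      exact not_congr (isUnit_map_iff e _)
    refine ⟨Q, hQprime, e, ψ, fun i => (hψ (s i)).symm, ?_, h d s hs Q hQn hQmax ψ hψcomp⟩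
    rw [Ideal.map_span, Ideal.span_le]
    constructor
    · intro hle i
      exact (hmemiff i).mp (hle ⟨s i, ⟨i, rfl⟩, rfl⟩)
    · rintro hall _ ⟨_, ⟨i, rfl⟩, rfl⟩
      exact (hmemiff i).mpr (hall i)
  refine inlineClause_of_retract p ρ' hρ'1 fun d s hs => ⟨fun P _ hP => ?_, fun P _ hP => ?_⟩
  · obtain ⟨Q, _, e, ψ, himg, hiff, hgood, -⟩ := key d s hs P
    obtain ⟨hLQ, e', hdimQ, hquotQ⟩ := hgood (hiff.mp hP)
    refine ⟨inlineClause_of_ringEquiv p e hLQ, e', ?_, ?_⟩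
    · rw [← ringKrullDim_eq_of_ringEquiv e, hdimQ]
    · have hfun : (fun i => algebraMap (Localization M) (Localization.AtPrime P)
          (algebraMap (Localization.AtPrime n) (Localization M) (s i))) =
          (e : Localization.AtPrime Q → Localization.AtPrime P) ∘ fun i => ψ (s i) :=
        funext fun i => himg i
      have hJ : Ideal.span (Set.range fun i => algebraMap (Localization M) (Localization.AtPrime P)
          (algebraMap (Localization.AtPrime n) (Localization M) (s i))) =
          (Ideal.span (Set.range fun i => ψ (s i))).map (e : Localization.AtPrime Q →+* _) := by
        rw [Ideal.map_span, hfun, Set.range_comp]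
        rfl
      rw [← hquotQ]
      exact (ringKrullDim_eq_of_ringEquiv (Ideal.quotientEquiv _ _ e hJ)).symm
  · obtain ⟨Q, _, e, ψ, himg, hiff, -, hoff⟩ := key d s hs P
    have hex : ∃ i, ψ (s i) ∉ maximalIdeal (Localization.AtPrime Q) := by
      by_contra hall
      simp only [not_exists, not_not] at hall
      exact hP (hiff.mpr hall)
    have h1 := isWeaklyRegular_map_ringEquiv e (hoff hex)
    have hl : (List.ofFn fun i => ψ (s i)).map e = List.ofFn fun i =>
        algebraMap (Localization M) (Localization.AtPrime P)
          (algebraMap (Localization.AtPrime n) (Localization M) (s i)) := by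
      rw [List.map_ofFn]
      congr 1
      funext i
      exact (himg i).symm
    rw [hl] at h1
    exact h1

/-! ## §3 The graded instance: `T₀ ⊆ T` a `ℤ`-graded Noetherian ring -/

omit [Fact (Nat.Prime p)] in
/-- A ring retract of a Noetherian ring is Noetherian: `I ↦ I·B` is a strictly monotone map from the ideals
of `A` to the ideals of `B` (`x ∈ J`, `x ∈ I·B` ⇒ `x = ρ x ∈ I`). In particular the degree-`0` part of a
`ℤ`-graded Noetherian ring is Noetherian. [folklore; BrunsHerzog1998 Thm 1.5.5] -/
theorem isNoetherianRing_of_retract {A B : Type} [CommRing A] [CommRing B] [Algebra A B]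
    (ρ : B →ₗ[A] A) (hρ : ρ 1 = 1) [IsNoetherianRing B] : IsNoetherianRing A := by
  have hmono : StrictMono fun I : Ideal A => I.map (algebraMap A B) := by
    intro I J hIJ
    refine lt_of_le_of_ne (Ideal.map_mono hIJ.le) fun hEq => hIJ.ne (le_antisymm hIJ.le fun x hx => ?_)
    have hEq' : I.map (algebraMap A B) = J.map (algebraMap A B) := hEq
    have hxB : algebraMap A B x ∈ I.map (algebraMap A B) := by
      rw [hEq']
      exact Ideal.mem_map_of_mem _ hx
    have := RetractClause.retract_mem ρ I hxB
    rwa [RetractClause.retract_algebraMap ρ hρ] at this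
  rw [isNoetherianRing_iff, isNoetherian_iff']
  exact hmono.wellFoundedGT

/-- **DEGREE-ZERO DESCENT FOR A `ℤ`-GRADED NOETHERIAN RING** (the form met on a weighted blow-up chart
`Spec T₀`, `T = A'_{a tᵏ}`): for `T = ⊕ₙ 𝒜 n` Noetherian of prime characteristic `p` and a prime `n` of
`T₀ = 𝒜 0`, the local ring `(T₀)_n` satisfies the crux's per-stalk clause as soon as, for every system of
parameters `s` of `(T₀)_n` and every prime `Q` of `T` maximal among those with `Q ∩ T₀ ⊆ n` (induced map
`ψ : (T₀)_n → T_Q`): if all `ψ(sᵢ)` are non-units then `T_Q` satisfies the clause with `dim T_Q = d + e`,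
`dim T_Q/(ψ s) = e`; otherwise the `ψ(sᵢ)` are still weakly regular on `T_Q`. The retraction is the
degree-`0` projection (`GradedZero.stub_projZeroRetract`); `T₀` is Noetherian by `isNoetherianRing_of_retract`.
[folklore; cf. card weighted-cone-deformation-descent, step (ii)] -/
theorem inlineClause_localization_gradeZero {T : Type} [CommRing T] [IsNoetherianRing T] [CharP T p]
    (𝒜 : ℤ → AddSubgroup T) [GradedRing 𝒜] (n : Ideal (𝒜 0)) [n.IsPrime]
    (h : ∀ (d : ℕ) (s : Fin d → Localization.AtPrime n), IsSystemOfParameters s →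
      ∀ (Q : Ideal T) [Q.IsPrime], Q.comap (algebraMap (𝒜 0) T) ≤ n →
        (∀ Q' : Ideal T, Q'.IsPrime → Q ≤ Q' → Q'.comap (algebraMap (𝒜 0) T) ≤ n → Q' ≤ Q) →
        ∀ ψ : Localization.AtPrime n →+* Localization.AtPrime Q,
          ψ.comp (algebraMap (𝒜 0) (Localization.AtPrime n)) =
            (algebraMap T (Localization.AtPrime Q)).comp (algebraMap (𝒜 0) T) →
          ((∀ i, ψ (s i) ∈ maximalIdeal (Localization.AtPrime Q)) →
            (∀ m : ℕ, ringKrullDim (Localization.AtPrime Q) = m → ∀ u : Fin m → Localization.AtPrime Q,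
              (Ideal.span (Set.range u)).radical.IsMaximal →
                IsWeaklyRegular (Localization.AtPrime Q) (List.ofFn u) ∧
                ∀ y : Localization.AtPrime Q, (∃ e : ℕ, y ^ p ^ e ∈ Ideal.span
                  ((fun z : Localization.AtPrime Q => z ^ p ^ e) ''
                    (Ideal.span (Set.range u) : Set (Localization.AtPrime Q)))) → y ∈ Ideal.span (Set.range u)) ∧
            ∃ e : ℕ, ringKrullDim (Localization.AtPrime Q) = ((d + e : ℕ) : WithBot ℕ∞) ∧
              ringKrullDim (Localization.AtPrime Q ⧸ Ideal.span (Set.range fun i => ψ (s i))) =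
                (e : WithBot ℕ∞)) ∧
          ((∃ i, ψ (s i) ∉ maximalIdeal (Localization.AtPrime Q)) →
            IsWeaklyRegular (Localization.AtPrime Q) (List.ofFn fun i => ψ (s i)))) :
    ∀ d : ℕ, ringKrullDim (Localization.AtPrime n) = d → ∀ s : Fin d → Localization.AtPrime n,
      (Ideal.span (Set.range s)).radical.IsMaximal →
      IsWeaklyRegular (Localization.AtPrime n) (List.ofFn s) ∧
      ∀ y : Localization.AtPrime n, (∃ e : ℕ, y ^ p ^ e ∈ Ideal.span
        ((fun z : Localization.AtPrime n => z ^ p ^ e) ''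
          (Ideal.span (Set.range s) : Set (Localization.AtPrime n)))) → y ∈ Ideal.span (Set.range s) := by
  obtain ⟨ρ, hρ⟩ := GradedZero.stub_projZeroRetract T 𝒜
  have hρ1 : ρ 1 = 1 := by simpa using hρ 1
  have hinj : Function.Injective (algebraMap (𝒜 0) T) := fun a b hab => by
    have ha := RetractClause.retract_algebraMap ρ hρ1 a
    rw [hab, RetractClause.retract_algebraMap ρ hρ1 b] at ha
    exact ha.symm
  haveI : CharP (𝒜 0) p := (algebraMap (𝒜 0) T).charP hinj p
  haveI : IsNoetherianRing (𝒜 0) := isNoetherianRing_of_retract ρ hρ1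
  exact inlineClause_localization_of_retract p ρ hρ1 n h

/-! ## Registered form -/

/-- **E4 for a `ℤ`-graded Noetherian ring, registered helper-stub form** (fully explicit binders;
= `inlineClause_localization_gradeZero`). [folklore; cf. card weighted-cone-deformation-descent step (ii)] -/
theorem stub_degreeZeroDescentGraded : ∀ (p : ℕ) [Fact p.Prime] (T : Type) [CommRing T] [IsNoetherianRing T] [CharP T p]
    (𝒜 : ℤ → AddSubgroup T) [GradedRing 𝒜] (n : Ideal (𝒜 0)) [n.IsPrime],
    (∀ (d : ℕ) (s : Fin d → Localization.AtPrime n),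
      Literature.RingTheory.TightClosure.IsSystemOfParameters s →
      ∀ (Q : Ideal T) [Q.IsPrime], Q.comap (algebraMap (𝒜 0) T) ≤ n →
        (∀ Q' : Ideal T, Q'.IsPrime → Q ≤ Q' → Q'.comap (algebraMap (𝒜 0) T) ≤ n → Q' ≤ Q) →
        ∀ ψ : Localization.AtPrime n →+* Localization.AtPrime Q,
          ψ.comp (algebraMap (𝒜 0) (Localization.AtPrime n)) =
            (algebraMap T (Localization.AtPrime Q)).comp (algebraMap (𝒜 0) T) →
          ((∀ i, ψ (s i) ∈ IsLocalRing.maximalIdeal (Localization.AtPrime Q)) →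
            (∀ m : ℕ, ringKrullDim (Localization.AtPrime Q) = m → ∀ u : Fin m → Localization.AtPrime Q,
              (Ideal.span (Set.range u)).radical.IsMaximal →
                RingTheory.Sequence.IsWeaklyRegular (Localization.AtPrime Q) (List.ofFn u) ∧
                ∀ y : Localization.AtPrime Q, (∃ e : ℕ, y ^ p ^ e ∈ Ideal.span
                  ((fun z : Localization.AtPrime Q => z ^ p ^ e) ''
                    (Ideal.span (Set.range u) : Set (Localization.AtPrime Q)))) → y ∈ Ideal.span (Set.range u)) ∧
            ∃ e : ℕ, ringKrullDim (Localization.AtPrime Q) = ((d + e : ℕ) : WithBot ℕ∞) ∧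
              ringKrullDim (Localization.AtPrime Q ⧸ Ideal.span (Set.range fun i => ψ (s i))) =
                (e : WithBot ℕ∞)) ∧
          ((∃ i, ψ (s i) ∉ IsLocalRing.maximalIdeal (Localization.AtPrime Q)) →
            RingTheory.Sequence.IsWeaklyRegular (Localization.AtPrime Q) (List.ofFn fun i => ψ (s i)))) →
    ∀ d : ℕ, ringKrullDim (Localization.AtPrime n) = d → ∀ s : Fin d → Localization.AtPrime n,
      (Ideal.span (Set.range s)).radical.IsMaximal →
      RingTheory.Sequence.IsWeaklyRegular (Localization.AtPrime n) (List.ofFn s) ∧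
      ∀ y : Localization.AtPrime n, (∃ e : ℕ, y ^ p ^ e ∈ Ideal.span
        ((fun z : Localization.AtPrime n => z ^ p ^ e) ''
          (Ideal.span (Set.range s) : Set (Localization.AtPrime n)))) → y ∈ Ideal.span (Set.range s) :=
  fun p _ _ _ _ _ 𝒜 _ n _ h => inlineClause_localization_gradeZero p 𝒜 n h

end Summit.ResolutionOfSingularities.ResolutionOfSingularities.Theorems.FInjectiveMacaulayfication.DegreeZeroDescent
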